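import Mathlib
import HarnessLib
import Summits.NavierStokesRegularity.NavierStokesRegularity.Theorems.PoloidalWindowDoorLrcModEntireTwistingTHFlatRidgeMixedPin
import Summits.NavierStokesRegularity.NavierStokesRegularity.Theorems.PoloidalWindowDoorPoloidalWindowRigidityVelocityGradientLaw
import Summits.NavierStokesRegularity.NavierStokesRegularity.Theorems.PoloidalWindowDoorPoloidalWindowRigidityMaterialLeibniz
import Summits.NavierStokesRegularity.NavierStokesRegularity.Theorems.PoloidalWindowDoorPoloidalWindowRigidityConstantShearSlice

/-!
# Item `LrcModEntire` (stmt-NavierStokesRegularity-20428) — tools for the fourth-order laws of the flat sub-cell: line calculus, the vertical residual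
# `f₂ = ∂ₜv₂ + (v·∇)v₂ − Δv₂` as a function, and the plane slice law `Δv₂ = (1 − μ₀)Δₕv₂` on a (TH) plane

ns-k2-port-2 g7, helper of item 20428 under LEAD ns-poloidal-K2-p3 g15 (`--supports stmt-NavierStokesRegularity-20428 --as helper`).  Bookkeeping consumed by
`…TwistingTHFlatRidgeQuarticPin` (space–time quartic pin) and `…TwistingTHFlatRidgeQuarticLaw` (`∂_ν²θ_t = ∂_ν²Δθ = ρ₀∂_ν²Δₕθ` at a flat hot point; memo T2B-g15 §17d):

* `deriv_line_apply`, `iteratedDeriv_two_line_apply` — `d/ds F(y+sν) = DF(y+sν)ν`, `d²/ds²|₀ F(y+sν) = D²F(y)[ν][ν]`;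
* `iteratedDeriv_two_mul_eq` — Leibniz at order two: `(fg)″(0) = f″g + 2f′g′ + fg″`;
* `residual_two_eq` — for a class profile, `x ↦ (∂ₜv + (v·∇)v − Δv)(−1,x)₂ = ∂ₜv₂(−1,x) + D(v₂(−1,·))(x)[v(−1,x)] − Δ(v₂(−1,·))(x)` as functions;
* `laplacian_two_eq_sum`, `laplacian_two_eq_rho_mul_horiz_of_plane` — `Δθ = ∂₀²θ + ∂₁²θ + ∂₂²θ` and, on a plane `{x₂ = c}` carrying the proportional-shear law with slope `μ₀`,
  `Δθ(x) = (1 − μ₀)(∂₀²θ + ∂₁²θ)(x)` (`…TimeHeightShearLinearSlice.plane_wave_identity`).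

WHAT THIS IS NOT: not a claim about Navier–Stokes regularity — calculus/bookkeeping (bears_on LADDER-NS N0, item 20428 / crux 19708; OPEN). [folklore]
-/

set_option linter.style.longLine false
set_option linter.dupNamespace false

namespace Summit.NavierStokesRegularity.NavierStokesRegularity.Theorems.PoloidalWindowDoorLrcModEntireTwistingTHFlatRidgeQuarticLawTools

open Set Function Filter Topology Metric
open scoped RealInnerProductSpace InnerProductSpace ContDiff Laplacian
open Literature.Analysis Literature.Analysis.FluidPDE Literature.Analysis.UnboundedOperators
open Summit.NavierStokesRegularity.NavierStokesRegularity.Theorems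
open Summit.NavierStokesRegularity.NavierStokesRegularity.Theorems.LocalSineTubeDoorProfileAlignedWindowRigidityAncient
open Summit.NavierStokesRegularity.NavierStokesRegularity.Theorems.PoloidalWindowDoorPoloidalWindowRigidityWindow
open Summit.NavierStokesRegularity.NavierStokesRegularity.Theorems.PoloidalWindowDoorPoloidalWindowRigidityLocalFrozenLaw
open Summit.NavierStokesRegularity.NavierStokesRegularity.Theorems.PoloidalWindowDoorPoloidalWindowRigidityVelocityGradientLaw
open Summit.NavierStokesRegularity.NavierStokesRegularity.Theorems.PoloidalWindowDoorPoloidalWindowRigidityMaterialLeibniz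
open Summit.NavierStokesRegularity.NavierStokesRegularity.Theorems.PoloidalWindowDoorPoloidalWindowRigidityConstantShearSlice
open Summit.NavierStokesRegularity.NavierStokesRegularity.Theorems.PoloidalWindowDoorPoloidalWindowRigidityTimeHeightShearLinearSlice
open Summit.NavierStokesRegularity.NavierStokesRegularity.Theorems.PoloidalWindowDoorLrcModEntireRidgeWiring
open Summit.NavierStokesRegularity.NavierStokesRegularity.Theorems.PoloidalWindowDoorLrcModEntireThreadPins
open Summit.NavierStokesRegularity.NavierStokesRegularity.Theorems.PoloidalWindowDoorLrcModEntireThreadPressure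
open Summit.NavierStokesRegularity.NavierStokesRegularity.Theorems.PoloidalWindowDoorLrcModEntireTwistingTHFlatRidgeMixedPin

/-! ### Class-free line calculus -/

section LineCalc

variable {E : Type*} [NormedAddCommGroup E] [NormedSpace ℝ E]

/-- `d/ds F(y + sν) = DF(y + sν) ν` for a differentiable `F`. [folklore] -/
theorem deriv_line_apply {F : E → ℝ} (hF : Differentiable ℝ F) (y ν : E) (s : ℝ) :
    deriv (fun s : ℝ => F (y + s • ν)) s = fderiv ℝ F (y + s • ν) ν := by
  have hline : HasDerivAt (fun s : ℝ => y + s • ν) ν s := by simpa using ((hasDerivAt_id s).smul_const ν).const_add y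
  exact ((hF (y + s • ν)).hasFDerivAt.comp_hasDerivAt s hline).deriv

/-- `d²/ds²|₀ F(y + sν) = D²F(y)[ν][ν]` for `F ∈ C²` (`iteratedDeriv` form of `…FlatRidgeMixedPin.deriv2_line_eq_fderiv_fderiv`). [folklore] -/
theorem iteratedDeriv_two_line_apply {F : E → ℝ} (hF : ContDiff ℝ 2 F) (y ν : E) :
    iteratedDeriv 2 (fun s : ℝ => F (y + s • ν)) 0 = fderiv ℝ (fderiv ℝ F) y ν ν := by
  rw [iteratedDeriv_succ, iteratedDeriv_one]
  exact deriv2_line_eq_fderiv_fderiv hF.contDiffAt ν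

/-- **Leibniz at order two:** `(fg)″(0) = f″(0)g(0) + 2f′(0)g′(0) + f(0)g″(0)` for `f, g ∈ C²`. [folklore] -/
theorem iteratedDeriv_two_mul_eq {f g : ℝ → ℝ} (hf : ContDiff ℝ 2 f) (hg : ContDiff ℝ 2 g) :
    iteratedDeriv 2 (fun s => f s * g s) 0 =
      deriv (deriv f) 0 * g 0 + 2 * (deriv f 0 * deriv g 0) + f 0 * deriv (deriv g) 0 := by
  have hfd : Differentiable ℝ f := hf.differentiable (by norm_num)
  have hgd : Differentiable ℝ g := hg.differentiable (by norm_num)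
  have hf'd : Differentiable ℝ (deriv f) := (hf.iterate_deriv' 1 1).differentiable (by norm_num)
  have hg'd : Differentiable ℝ (deriv g) := (hg.iterate_deriv' 1 1).differentiable (by norm_num)
  rw [iteratedDeriv_succ, iteratedDeriv_one]
  have hd1 : deriv (fun s => f s * g s) = fun s => deriv f s * g s + f s * deriv g s :=
    funext fun s => ((hfd s).hasDerivAt.mul (hgd s).hasDerivAt).deriv
  rw [hd1]
  have h := (((hf'd 0).hasDerivAt.mul (hgd 0).hasDerivAt).add ((hfd 0).hasDerivAt.mul (hg'd 0).hasDerivAt)).deriv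
  change deriv (fun s => deriv f s * g s + f s * deriv g s) 0 = _ at h
  rw [h]
  ring

end LineCalc

/-! ### The Laplacian of a scalar in coordinates; the slice law on a proportional-shear plane -/

/-- `Δθ(x) = ∂₀∂₀θ(x) + ∂₁∂₁θ(x) + ∂₂∂₂θ(x)` for `θ ∈ C²` on `ℝ³`. [folklore] -/
theorem laplacian_two_eq_sum {θ : EuclideanSpace ℝ (Fin 3) → ℝ} (hθ : ContDiff ℝ 2 θ) (x : EuclideanSpace ℝ (Fin 3)) :
    (Δ θ) x = fderiv ℝ (fun x' => fderiv ℝ θ x' (EuclideanSpace.single 0 1)) x (EuclideanSpace.single 0 1) +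
      fderiv ℝ (fun x' => fderiv ℝ θ x' (EuclideanSpace.single 1 1)) x (EuclideanSpace.single 1 1) +
      fderiv ℝ (fun x' => fderiv ℝ θ x' (EuclideanSpace.single 2 1)) x (EuclideanSpace.single 2 1) := by
  rw [InnerProductSpace.laplacian_eq_iteratedFDeriv_orthonormalBasis θ (EuclideanSpace.basisFun (Fin 3) ℝ)]
  simp only [Fin.sum_univ_three, EuclideanSpace.basisFun_apply, iteratedFDeriv_two_apply, Matrix.cons_val_zero, Matrix.cons_val_one,
    fderiv_fderiv_eq_coord hθ]

/-- **Slice law on a proportional-shear plane:** if the `C²` divergence-free field `u` satisfies `∂₂u_b = μ₀∂_bu₂` (`b = 0,1`) on the plane `{x₂ = c}`, then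
`Δu₂(x) = (1 − μ₀)·(∂₀∂₀u₂ + ∂₁∂₁u₂)(x)` at every point `x` of that plane (`…plane_wave_identity`: `∂₂∂₂u₂ = −μ₀Δₕu₂`). -/
theorem laplacian_two_eq_rho_mul_horiz_of_plane {u : EuclideanSpace ℝ (Fin 3) → EuclideanSpace ℝ (Fin 3)} {μ₀ c : ℝ} (hu : ContDiff ℝ 2 u)
    (hdiv : ∀ x, fderiv ℝ u x (EuclideanSpace.single 0 (1 : ℝ)) 0 + fderiv ℝ u x (EuclideanSpace.single 1 (1 : ℝ)) 1 +
      fderiv ℝ u x (EuclideanSpace.single 2 (1 : ℝ)) 2 = 0)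
    (hslope : ∀ y : EuclideanSpace ℝ (Fin 3), y 2 = c → ∀ b : Fin 3, b ≠ 2 →
      fderiv ℝ u y (EuclideanSpace.single 2 (1 : ℝ)) b = μ₀ * fderiv ℝ u y (EuclideanSpace.single b (1 : ℝ)) 2)
    {x : EuclideanSpace ℝ (Fin 3)} (hx : x 2 = c) :
    (Δ (fun x' => (u x' 2 : ℝ))) x = (1 - μ₀) *
      (fderiv ℝ (fun x' => fderiv ℝ (fun y' => (u y' 2 : ℝ)) x' (EuclideanSpace.single 0 1)) x (EuclideanSpace.single 0 1) +
        fderiv ℝ (fun x' => fderiv ℝ (fun y' => (u y' 2 : ℝ)) x' (EuclideanSpace.single 1 1)) x (EuclideanSpace.single 1 1)) := by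
  have hθ : ContDiff ℝ 2 (fun y' => (u y' 2 : ℝ)) := (EuclideanSpace.proj (𝕜 := ℝ) (2 : Fin 3)).contDiff.comp hu
  rw [laplacian_two_eq_sum hθ x, plane_wave_identity hu hdiv hslope hx]
  ring

/-! ### The vertical residual of a class profile as a function of `x` -/

variable {C : ℝ} {v : ℝ → EuclideanSpace ℝ (Fin 3) → EuclideanSpace ℝ (Fin 3)}

/-- **The vertical residual in components:** for a class profile and every `x`,
`(∂ₜv + (v·∇)v − Δv)(−1,x)₂ = ∂ₜv₂(−1,x) + D(v₂(−1,·))(x)[v(−1,x)] − Δ(v₂(−1,·))(x)` (as an identity of functions of `x`). -/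
theorem residual_two_eq (hrate : HasTypeITimeDecay C v) (hcont : ContinuousOn (uncurry v) (Iio (0 : ℝ) ×ˢ univ))
    (hmild : ∀ s t : ℝ, s < t → t < 0 → ∀ x, v t x = heatExtension (v s) (t - s) x - oseenDuhamel 1 s v v t x)
    (hdiv : ∀ t < 0, VectorCalculus.IsDivFree (v t)) :
    (fun x => (timeDerivWithin (Iio 0) v (-1) x + convect (v (-1)) (v (-1)) x - Δ (v (-1)) x) 2) =
      fun x => deriv (fun s => v s x 2) (-1) + fderiv ℝ (fun x' => (v (-1) x' 2 : ℝ)) x (v (-1) x) - (Δ (fun x' => (v (-1) x' 2 : ℝ))) x := by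
  have h1 : (-1 : ℝ) < 0 := by norm_num
  have hA : IsTypeIAncientMild C v := isTypeIAncientMild_of_class hrate hcont hmild hdiv
  have hsm : IsSmoothSpaceTimeOn (Iio (0 : ℝ)) v := hA.contDiffOn
  have hs : ContDiff ℝ ∞ (v (-1)) := hA.contDiff_slice h1
  funext x
  simp only [PiLp.add_apply, PiLp.sub_apply]
  have hT : timeDerivWithin (Iio 0) v (-1) x 2 = deriv (fun s => v s x 2) (-1) := by
    rw [timeDerivWithin_eq_deriv isOpen_Iio h1 v x]
    exact deriv_apply_coord (hsm.hasDerivAt_timeLine isOpen_Iio h1 x).differentiableAt 2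
  have hCv : convect (v (-1)) (v (-1)) x 2 = fderiv ℝ (fun x' => (v (-1) x' 2 : ℝ)) x (v (-1) x) := by
    rw [convect_apply]
    exact (fderiv_apply_coord (v (-1)) ((hs.differentiable (by simp)) x) (v (-1) x) 2).symm
  have hL : (Δ (v (-1))) x 2 = (Δ (fun x' => (v (-1) x' 2 : ℝ))) x := laplacian_apply_coord ((hs.of_le (by norm_cast)).contDiffAt) 2
  rw [hT, hCv, hL]

/-- The vertical residual `x ↦ (∂ₜv + (v·∇)v − Δv)(−1,x)₂` of a class profile is smooth. -/
theorem contDiff_residual_two (hrate : HasTypeITimeDecay C v) (hcont : ContinuousOn (uncurry v) (Iio (0 : ℝ) ×ˢ univ))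
    (hmild : ∀ s t : ℝ, s < t → t < 0 → ∀ x, v t x = heatExtension (v s) (t - s) x - oseenDuhamel 1 s v v t x)
    (hdiv : ∀ t < 0, VectorCalculus.IsDivFree (v t)) :
    ContDiff ℝ ∞ (fun x => (timeDerivWithin (Iio 0) v (-1) x + convect (v (-1)) (v (-1)) x - Δ (v (-1)) x) 2) := by
  have h1 : (-1 : ℝ) < 0 := by norm_num
  have hA : IsTypeIAncientMild C v := isTypeIAncientMild_of_class hrate hcont hmild hdiv
  have hs : ContDiff ℝ ∞ (v (-1)) := hA.contDiff_slice h1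
  have ht : ContDiff ℝ ∞ (timeDerivWithin (Iio 0) v (-1)) := by
    rw [timeDerivWithin_Iio_eq_deriv h1]; exact contDiff_timeDeriv_slice hrate hcont hmild hdiv h1
  have hc : ContDiff ℝ ∞ (fun x => convect (v (-1)) (v (-1)) x) := (hs.fderiv_right (m := ∞) (by norm_cast)).clm_apply hs
  have hL : ContDiff ℝ ∞ (Δ (v (-1))) := contDiff_infty.2 fun n => contDiff_laplacian (n := n) (contDiff_infty.1 hs (n + 2))
  exact (EuclideanSpace.proj (𝕜 := ℝ) (2 : Fin 3)).contDiff.comp ((ht.add hc).sub hL)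

/-- The three summands of the vertical residual are smooth: `∂ₜv₂(−1,·)`, `D(v₂(−1,·))(·)[v(−1,·)]`, `Δ(v₂(−1,·))`. -/
theorem contDiff_residual_summands (hrate : HasTypeITimeDecay C v) (hcont : ContinuousOn (uncurry v) (Iio (0 : ℝ) ×ˢ univ))
    (hmild : ∀ s t : ℝ, s < t → t < 0 → ∀ x, v t x = heatExtension (v s) (t - s) x - oseenDuhamel 1 s v v t x) :
    ContDiff ℝ ∞ (fun x => deriv (fun s => v s x 2) (-1)) ∧
      ContDiff ℝ ∞ (fun x => fderiv ℝ (fun x' => (v (-1) x' 2 : ℝ)) x (v (-1) x)) ∧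
      ContDiff ℝ ∞ (Δ (fun x' => (v (-1) x' 2 : ℝ))) := by
  have h1 : (-1 : ℝ) ∈ Iio (0 : ℝ) := by norm_num
  have hθst := isSmoothSpaceTimeOn_two hrate hcont hmild
  have hθ : ContDiff ℝ ∞ (fun x' => (v (-1) x' 2 : ℝ)) := hθst.contDiff_slice h1
  have hsm : IsSmoothSpaceTimeOn (Iio (0 : ℝ)) v :=
    (analyticOnNhd_uncurry hcont (bdd_of_hasTypeITimeDecay hrate) hmild).contDiffOn_of_completeSpace
  have hs : ContDiff ℝ ∞ (v (-1)) := hsm.contDiff_slice h1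
  refine ⟨(hθst.isSmoothSpaceTimeOn_deriv isOpen_Iio).contDiff_slice h1, (hθ.fderiv_right (m := ∞) (by norm_cast)).clm_apply hs, ?_⟩
  exact contDiff_infty.2 fun n => contDiff_laplacian (n := n) (contDiff_infty.1 hθ (n + 2))

end Summit.NavierStokesRegularity.NavierStokesRegularity.Theorems.PoloidalWindowDoorLrcModEntireTwistingTHFlatRidgeQuarticLawTools
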